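import Summits.NavierStokesRegularity.NavierStokesRegularity.Theses.QuantisedSymmetry
import Summits.NavierStokesRegularity.NavierStokesRegularity.Theses.Blowup
import Summits.NavierStokesRegularity.NavierStokesRegularity.Theses.FilamentSkeletonRss
import Summits.NavierStokesRegularity.NavierStokesRegularity.Theorems.QuantisedSymmetryPolyhedralTruncationBridge
import Summits.NavierStokesRegularity.NavierStokesRegularity.Theorems.FilamentSkeletonRssRdssProfileTruncation
import Literature.Analysis.FluidPDE.SelfSimilar
import Literature.Analysis.FluidPDE.SelfSimilarLiouville

/-!
# Strategist sketch S22g2 — typed companion of `STRATEGY-CENSUS-s22.md` (family s, gen 2)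

Crux: `Theses.QuantisedSymmetry.PolyhedralDssProfileExists` (stmt-NavierStokesRegularity-1404).

Sorry-free facts recorded here (all by tree theorems already landed):

* `crux_decides` — the crux ALONE decides the sub-problem: `C → ¬ NavierStokesRegularity`
  (route glue `closes` + the two proved co-binders `quantisedSymmetry_polyhedralTruncationBridge_proof`
  (stmt-11331) and `ClayUniqueness_holds` (stmt-0153)).
* `W0` — the weakest intermediate the summit-down analysis produces: drop the symmetry group `G`
  (sector-free rotated-DSS Type-I ancient mild profile = the antecedent of the PROVED bridge
  `FilamentSkeletonRss.RdssProfileTruncation`, stmt-11289).  `W0_of_crux : C → W0`,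
  `W0_decides : W0 → ¬ NavierStokesRegularity`, and `W0_iff_blowupTypeIDssProfile : W0 ↔ stmt-0155`
  (the open ∃-crux of route Blowup = ¬ Tsai's Type-I (rotated) DSS Liouville conjecture).
  So every weaker intermediate that can stand in `closes` is itself summit-deciding and is an
  already-filed open crux of another route: no leverage short of the summit is gained by weakening.
-/

namespace Summit.NavierStokesRegularity.NavierStokesRegularity.Cruxes.PolyhedralDssProfileExists.S22g2

open MeasureTheory
open Literature.Analysis.FluidPDE
open Summit.NavierStokesRegularity.NavierStokesRegularity

/-- The crux alone decides the sub-problem (negatively), by landed theorems only. -/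
theorem crux_decides :
    Theses.QuantisedSymmetry.PolyhedralDssProfileExists → ¬ _root_.NavierStokesRegularity :=
  fun hX => Theses.QuantisedSymmetry.closes hX
    Theorems.quantisedSymmetry_polyhedralTruncationBridge_proof
    Theses.QuantisedSymmetry.ClayUniqueness_holds

/-- `W0`: the sector-free weakening of the crux — a nontrivial Type-I rotated-`λ`-DSS ancient mild
profile exists for SOME factor `λ > 1` and SOME rotation `R` (no symmetry group, no irreducibility).
Literally the antecedent of `Theses.FilamentSkeletonRss.RdssProfileTruncation`. -/
def W0 : Prop :=
  ∃ (c : ℝ) (R : EuclideanSpace ℝ (Fin 3) ≃ₗᵢ[ℝ] EuclideanSpace ℝ (Fin 3))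
    (u : ℝ → EuclideanSpace ℝ (Fin 3) → EuclideanSpace ℝ (Fin 3)),
    1 < c ∧ IsAncientMildSolution 1 u ∧ (∀ t < 0, AEStronglyMeasurable (u t) volume) ∧
    IsRotatedDSS c R u ∧ (∃ C₀ : ℝ, HasTypeIDecay C₀ u) ∧ ¬ (∀ t < 0, u t =ᵐ[volume] 0)

/-- The crux implies its sector-free weakening (forget `G`; plain DSS = rotated DSS at `R = refl`). -/
theorem W0_of_crux : Theses.QuantisedSymmetry.PolyhedralDssProfileExists → W0 := by
  rintro ⟨_G, _hfin, _hdet, _hirr, c, hc, u, hanc, hmeas, hdss, hdec, _heqv, hnt⟩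
  exact ⟨c, LinearIsometryEquiv.refl ℝ (EuclideanSpace ℝ (Fin 3)), u, hc, hanc, hmeas,
    isRotatedDSS_refl_iff.mpr hdss, hdec, hnt⟩

/-- The weakening STILL decides the sub-problem: proved rotated truncation bridge (stmt-11289)
+ route Blowup's deciding theorem with its proved Clay-uniqueness co-binder. -/
theorem W0_decides : W0 → ¬ _root_.NavierStokesRegularity :=
  fun h => Theses.Blowup.closes (Theorems.filamentSkeletonRss_rdssProfileTruncation_proof h)
    Theses.Blowup.BlowupClayUniqueness_holds

/-- `W0` is exactly route Blowup's open crux #5 `BlowupTypeIDssProfile` (stmt-0155), i.e. the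
negation of Tsai's Type-I (rotated) `λ`-DSS Liouville conjecture. -/
theorem W0_iff_blowupTypeIDssProfile : W0 ↔ Theses.Blowup.BlowupTypeIDssProfile := by
  constructor
  · rintro ⟨c, R, u, hc, hanc, hmeas, hrdss, hdec, hnt⟩ hL
    exact hnt ((hL c).2 R hc u hanc hmeas hrdss hdec)
  · intro hW
    by_contra hW0
    apply hW
    intro c
    refine ⟨?_, ?_⟩
    · intro hc u hanc hmeas hdss hdec
      by_contra hnt
      exact hW0 ⟨c, LinearIsometryEquiv.refl ℝ (EuclideanSpace ℝ (Fin 3)), u, hc, hanc, hmeas,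
        isRotatedDSS_refl_iff.mpr hdss, hdec, hnt⟩
    · intro R hc u hanc hmeas hrdss hdec
      by_contra hnt
      exact hW0 ⟨c, R, u, hc, hanc, hmeas, hrdss, hdec, hnt⟩

/-- Hence the crux implies stmt-0155 (the sector-free ∃-crux of route Blowup). -/
theorem blowupTypeIDssProfile_of_crux :
    Theses.QuantisedSymmetry.PolyhedralDssProfileExists → Theses.Blowup.BlowupTypeIDssProfile :=
  fun h => W0_iff_blowupTypeIDssProfile.mp (W0_of_crux h)

end Summit.NavierStokesRegularity.NavierStokesRegularity.Cruxes.PolyhedralDssProfileExists.S22g2
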